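import Summits.Ventures.CertifiedArithmetic.LowPrec.DoubleRounding
import Summits.Ventures.CertifiedArithmetic.LowPrec.FormatsP3109

/-!
# Double rounding of sums: verdicts for the IEEE P3109 `binary8pP` formats (and FNUZ)

HONEST FRAMING (venture CertifiedArithmetic / cell `pub-lowprec`): certified error envelopes and
provably optimal rounding/accumulation schemes for low-precision formats under stated cost models;
every table by two implementations; no hardware or vendor claims.

`MiniFloat.toRat_roundNE_roundNE_add` ("add two `φ`-data in `ψ`, convert to `φ`" = correctly
rounded `φ`-addition for ALL data; both roundings RNE saturating) instantiated for the P3109 value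
sets of `FormatsP3109.lean` (`binary8p3/p4/p5` Extended, `binary8p3f/p4f` Finite = FNUZ
`E5M2`/`E4M3`):
* via `binary32`: all five — YES (thm);
* via `binary16`: `binary8p4`, `binary8p4f`, `binary8p5` — YES (thm: `11 ≥ 2p+1 = 9, 9, 11`;
  `bias 8, 8, 4 ≤ 15`). `binary8p3(f)` is NOT covered by the theorem (its `emin = -15` lies below
  binary16's `-14`, hypothesis `bias_φ ≤ bias_ψ` fails) and nothing is claimed for it;
* via `bfloat16`: `binary8p3`, `binary8p3f` — YES (thm, `8 ≥ 7`); `binary8p4`, `binary8p4f` — NO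
  (kernel counterexample `9/8 + 15/256 ↦ 5/4` vs `9/8`, the `E4M3` witness: `p = 8 = 2·4`);
  `binary8p5` — NO (kernel counterexample `17/2 + 7/32 ↦ 9` vs `17/2`: `p = 8 < 2·5 + 1`).
-/

namespace Literature.ComputerArithmetic.FloatingPoint

namespace Format

open MiniFloat

/-- via `binary32`: `binary8p3` sums. [cite: Figueroa1995, §2] -/
theorem Binary8p3_add_via_Binary32 (a b : MiniFloat Binary8p3) :
    (roundNE Binary8p3 (roundNE Binary32 (a.toRat + b.toRat)).toRat).toRat
      = (roundNE Binary8p3 (a.toRat + b.toRat)).toRat :=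
  toRat_roundNE_roundNE_add (by decide) (by decide) (by decide +kernel) a b

/-- via `binary32`: `binary8p4` sums. [cite: Figueroa1995, §2] -/
theorem Binary8p4_add_via_Binary32 (a b : MiniFloat Binary8p4) :
    (roundNE Binary8p4 (roundNE Binary32 (a.toRat + b.toRat)).toRat).toRat
      = (roundNE Binary8p4 (a.toRat + b.toRat)).toRat :=
  toRat_roundNE_roundNE_add (by decide) (by decide) (by decide +kernel) a b

/-- via `binary32`: `binary8p5` sums. [cite: Figueroa1995, §2] -/
theorem Binary8p5_add_via_Binary32 (a b : MiniFloat Binary8p5) :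
    (roundNE Binary8p5 (roundNE Binary32 (a.toRat + b.toRat)).toRat).toRat
      = (roundNE Binary8p5 (a.toRat + b.toRat)).toRat :=
  toRat_roundNE_roundNE_add (by decide) (by decide) (by decide +kernel) a b

/-- via `binary32`: `binary8p3f` (= FNUZ `E5M2`) sums. [cite: Figueroa1995, §2] -/
theorem Binary8p3F_add_via_Binary32 (a b : MiniFloat Binary8p3F) :
    (roundNE Binary8p3F (roundNE Binary32 (a.toRat + b.toRat)).toRat).toRat
      = (roundNE Binary8p3F (a.toRat + b.toRat)).toRat :=
  toRat_roundNE_roundNE_add (by decide) (by decide) (by decide +kernel) a b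

/-- via `binary32`: `binary8p4f` (= FNUZ `E4M3`) sums. [cite: Figueroa1995, §2] -/
theorem Binary8p4F_add_via_Binary32 (a b : MiniFloat Binary8p4F) :
    (roundNE Binary8p4F (roundNE Binary32 (a.toRat + b.toRat)).toRat).toRat
      = (roundNE Binary8p4F (a.toRat + b.toRat)).toRat :=
  toRat_roundNE_roundNE_add (by decide) (by decide) (by decide +kernel) a b

/-- via `binary16`: `binary8p4` sums (`11 ≥ 9`). [cite: Figueroa1995, §2] -/
theorem Binary8p4_add_via_Binary16 (a b : MiniFloat Binary8p4) :
    (roundNE Binary8p4 (roundNE Binary16 (a.toRat + b.toRat)).toRat).toRat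
      = (roundNE Binary8p4 (a.toRat + b.toRat)).toRat :=
  toRat_roundNE_roundNE_add (by decide) (by decide) (by decide +kernel) a b

/-- via `binary16`: `binary8p4f` sums. [cite: Figueroa1995, §2] -/
theorem Binary8p4F_add_via_Binary16 (a b : MiniFloat Binary8p4F) :
    (roundNE Binary8p4F (roundNE Binary16 (a.toRat + b.toRat)).toRat).toRat
      = (roundNE Binary8p4F (a.toRat + b.toRat)).toRat :=
  toRat_roundNE_roundNE_add (by decide) (by decide) (by decide +kernel) a b

/-- via `binary16`: `binary8p5` sums (`11 ≥ 2·5 + 1`, the boundary case). [cite: Figueroa1995, §2] -/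
theorem Binary8p5_add_via_Binary16 (a b : MiniFloat Binary8p5) :
    (roundNE Binary8p5 (roundNE Binary16 (a.toRat + b.toRat)).toRat).toRat
      = (roundNE Binary8p5 (a.toRat + b.toRat)).toRat :=
  toRat_roundNE_roundNE_add (by decide) (by decide) (by decide +kernel) a b

/-- via `bfloat16`: `binary8p3` sums (`8 ≥ 7`). [cite: Figueroa1995, §2] -/
theorem Binary8p3_add_via_BFloat16 (a b : MiniFloat Binary8p3) :
    (roundNE Binary8p3 (roundNE BFloat16 (a.toRat + b.toRat)).toRat).toRat
      = (roundNE Binary8p3 (a.toRat + b.toRat)).toRat :=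
  toRat_roundNE_roundNE_add (by decide) (by decide) (by decide +kernel) a b

/-- via `bfloat16`: `binary8p3f` (FNUZ `E5M2`) sums. [cite: Figueroa1995, §2] -/
theorem Binary8p3F_add_via_BFloat16 (a b : MiniFloat Binary8p3F) :
    (roundNE Binary8p3F (roundNE BFloat16 (a.toRat + b.toRat)).toRat).toRat
      = (roundNE Binary8p3F (a.toRat + b.toRat)).toRat :=
  toRat_roundNE_roundNE_add (by decide) (by decide) (by decide +kernel) a b

/-! ### Counterexamples via `bfloat16` -/

/-- `binary8p4` via `bfloat16` is NOT innocuous: `9/8 + 15/256 ↦` midpoint `19/16 ↦ 5/4`, correct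
`9/8` (the `E4M3` witness; `p = 8 = 2·4`). [cite: Figueroa1995, §2] -/
theorem Binary8p4_add_via_BFloat16_counterexample :
    let a : MiniFloat Binary8p4 := ⟨false, 8, 1, by decide, by decide, by decide⟩
    let b : MiniFloat Binary8p4 := ⟨false, 3, 7, by decide, by decide, by decide⟩
    a.toRat = 9 / 8 ∧ b.toRat = 15 / 256 ∧
    (roundNE Binary8p4 (roundNE BFloat16 (a.toRat + b.toRat)).toRat).toRat = 5 / 4 ∧
    (roundNE Binary8p4 (a.toRat + b.toRat)).toRat = 9 / 8 := by
  decide +kernel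

/-- `binary8p4f` (FNUZ `E4M3`) via `bfloat16`: the same witness. [cite: Figueroa1995, §2] -/
theorem Binary8p4F_add_via_BFloat16_counterexample :
    let a : MiniFloat Binary8p4F := ⟨false, 8, 1, by decide, by decide, by decide⟩
    let b : MiniFloat Binary8p4F := ⟨false, 3, 7, by decide, by decide, by decide⟩
    (roundNE Binary8p4F (roundNE BFloat16 (a.toRat + b.toRat)).toRat).toRat = 5 / 4 ∧
    (roundNE Binary8p4F (a.toRat + b.toRat)).toRat = 9 / 8 := by
  decide +kernel

/-- `binary8p5` via `bfloat16` is NOT innocuous: `a = 17/2`, `b = 7/32`: `a + b = 279/32`;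
bfloat16 rounds to the `binary8p5` midpoint `35/4` (tie, to even), which `binary8p5` rounds to the
even `9`; the correctly rounded sum is `17/2`. [cite: Figueroa1995, §2] -/
theorem Binary8p5_add_via_BFloat16_counterexample :
    let a : MiniFloat Binary8p5 := ⟨false, 7, 1, by decide, by decide, by decide⟩
    let b : MiniFloat Binary8p5 := ⟨false, 1, 12, by decide, by decide, by decide⟩
    a.toRat = 17 / 2 ∧ b.toRat = 7 / 32 ∧
    (roundNE BFloat16 (a.toRat + b.toRat)).toRat = 35 / 4 ∧
    (roundNE Binary8p5 (roundNE BFloat16 (a.toRat + b.toRat)).toRat).toRat = 9 ∧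
    (roundNE Binary8p5 (a.toRat + b.toRat)).toRat = 17 / 2 := by
  decide +kernel

/-- Hence the general statements fail for (`binary8p4`, `bfloat16`) and (`binary8p5`, `bfloat16`).
[cite: Figueroa1995, §2] -/
theorem Binary8p4_p5_add_via_BFloat16_not_innocuous :
    (¬ ∀ a b : MiniFloat Binary8p4, (roundNE Binary8p4 (roundNE BFloat16 (a.toRat + b.toRat)).toRat).toRat
      = (roundNE Binary8p4 (a.toRat + b.toRat)).toRat) ∧
    (¬ ∀ a b : MiniFloat Binary8p5, (roundNE Binary8p5 (roundNE BFloat16 (a.toRat + b.toRat)).toRat).toRat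
      = (roundNE Binary8p5 (a.toRat + b.toRat)).toRat) := by
  constructor
  · intro h
    have h1 := h ⟨false, 8, 1, by decide, by decide, by decide⟩ ⟨false, 3, 7, by decide, by decide, by decide⟩
    obtain ⟨-, -, h2, h3⟩ := Binary8p4_add_via_BFloat16_counterexample
    rw [h2, h3] at h1; norm_num at h1
  · intro h
    have h1 := h ⟨false, 7, 1, by decide, by decide, by decide⟩ ⟨false, 1, 12, by decide, by decide, by decide⟩
    obtain ⟨-, -, -, h2, h3⟩ := Binary8p5_add_via_BFloat16_counterexample
    rw [h2, h3] at h1; norm_num at h1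

end Format

end Literature.ComputerArithmetic.FloatingPoint
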